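import Summits.HodgeConjecture.HodgeConjecture.Theorems.EndoscopicMiddleDegreeOrthogonalEnvelopedHeckeGraphAnalytic
import Literature.Topology.CoveringSpaces.OrbitQuotientCovering

/-!
# Stub `stub_coverMap_map_hecke` (line `purity-sorted-hecke-envelope` of crux
# `EndoscopicMiddleDegree.OrthogonalEnveloped`, stmt-HodgeConjecture-14300): a translated projection applied
# to a Hecke operator

Registered skeleton `Cruxes/OrthogonalEnveloped/Lines/purity_sorted_hecke_envelope.lean` (rev c6-L2, Stub H2);
this is the file `Theorems/EndoscopicMiddleDegreeOrthogonalEnvelopedCoverMapHecke.lean` of the summit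
(`--supports stmt-HodgeConjecture-14300`).

WHAT IS PROVED (`stub_coverMap_map_hecke`, signature byte-identical with the registered stub). Let
`D : UnitaryBallQuotientDatum p X` (`X(ℂ) ≅ Γ \ 𝔹`), `g, h ∈ U(V)(F)`, `N_h ⊴ Γ` the Hecke level of `h` and
`M ⊴ Γ` a normal subgroup with `g M g⁻¹ ⊆ N_h`. Then the translated projection `π_g^M : M \ 𝔹 → X(ℂ)`,
`M[v] ↦ Γ[g v]` (`D.coverMap g`), applied to the Hecke operator `T_h` reads
`(π_g^M)^* (T_h x) = [Γ ∩ h⁻¹Γh : N_h]⁻¹ Σ_{q' ∈ Γ/N_h} (π^M_{h γ_{q'} g})^* x`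
for any section `γ_{q'} = s q'` of `Γ → Γ/N_h`.

HOW (Shimura 1971, §3.1 Prop. 3.1 and §3.4 (3.4.1): `Γ h Γ = ⊔ Γ h γ_{q'}`, `(T_h f)(g v) = Σ f(h γ_{q'} g v)`).
* `π_g^M` factors through the level-`N_h` cover: there is a continuous `ĝ : M \ 𝔹 → N_h \ 𝔹`,
  `M[v] ↦ N_h[g v]` (well defined since `g m v = (g m g⁻¹) g v` and `g M g⁻¹ ⊆ N_h`;
  `coverMapHecke_exists_levelMap`), with `π_{N_h} ∘ ĝ = π_g^M`.
* Pull the DEFINING IDENTITY of `T_h` on `N_h \ 𝔹` (`levelProj_map_heckeCorrespondenceAction`: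
  `π_{N_h}^* (T_h x) = [Γ ∩ h⁻¹Γh : N_h]⁻¹ Σ_{q'} (π_h ∘ q')^* x`) back along `ĝ`, and identify the summands:
  `π_h ∘ (γ_{q'} N_h) ∘ ĝ : M[v] ↦ Γ[h γ_{q'} g v]` is the translated projection `π^M_{h γ_{q'} g}`.
-/

noncomputable section

-- The crux-workfile namespace `Summit.<P>.<Sub>.Cruxes.…` repeats `HodgeConjecture` (single-conjunct summit).
set_option linter.dupNamespace false

namespace Summit.HodgeConjecture.HodgeConjecture.Cruxes.OrthogonalEnveloped.PuritySortedHeckeEnvelope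

open scoped BigOperators
open Literature.AlgebraicGeometry.Motives (SchemeOver ComplexPoints IsSmoothProjective)
open Literature.AlgebraicGeometry.HodgeTheory
open Literature.AlgebraicGeometry.ShimuraVarieties
open Literature.AlgebraicTopology.SingularHomology
open Literature.Topology.CoveringSpaces
open Summit.HodgeConjecture.HodgeConjecture.Cruxes.OrthogonalEnveloped.HeckeGraphChow
  (isHeckeAdmissible_of_mem_unitaryGroup)

variable {p : ℕ} {X : SchemeOver ℂ}

/-! ## The change-of-level map `M \ 𝔹 → N \ 𝔹`, `M[v] ↦ N[g v]` -/

/-- **The translated change-of-level map.** For `g ∈ U(V)(F)` and subgroups `M, N ≤ Γ` with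
`g M g⁻¹ ⊆ N` there is a continuous map `ĝ : M \ 𝔹 → N \ 𝔹` with `ĝ (M[v]) = N[g v]` on the negative cone:
`v ↦ g v` preserves the cone (`g` is an isometry), commutes with scalars, and `g (m v) = (g m g⁻¹) (g v)` with
`g m g⁻¹ ∈ N` for `m ∈ M`, so it descends to the ball and then to the level covers.
[cite: Shimura1973, §7.3 and §3.1 Prop. 3.1] -/
theorem coverMapHecke_exists_levelMap (D : UnitaryBallQuotientDatum p X) {g : GL (Fin (p + 1)) D.E}
    (hg : g ∈ unitaryGroup (conjRingHom D.E) D.H) (M N : Subgroup ↥D.Γ)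
    (hMg : ∀ γ ∈ M, g * (γ : GL (Fin (p + 1)) D.E) * g⁻¹ ∈ D.Γ)
    (hMN : ∀ γ (hγ : γ ∈ M), (⟨g * (γ : GL (Fin (p + 1)) D.E) * g⁻¹, hMg γ hγ⟩ : ↥D.Γ) ∈ N) :
    ∃ ĝ : C(D.LevelCover M, D.LevelCover N), ∀ v : D.cone,
      ĝ (D.toLevel M (D.toBall v)) =
        D.toLevel N (D.toBall ⟨D.act g v, D.act_mem_cone_of_mem_unitaryGroup hg v.2⟩) := by
  -- the map on the negative cone, `v ↦ g v`
  have hC : Continuous (fun v : D.cone ↦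
      (⟨D.act g v, D.act_mem_cone_of_mem_unitaryGroup hg v.2⟩ : D.cone)) :=
    ((D.continuous_act g).comp continuous_subtype_val).subtype_mk _
  -- it commutes with the scalars, so descends to the ball
  let gB : D.ball → D.ball := Quotient.map'
    (fun v : D.cone ↦ (⟨D.act g v, D.act_mem_cone_of_mem_unitaryGroup hg v.2⟩ : D.cone))
    fun v w hvw ↦ by
      obtain ⟨c, rfl⟩ := MulAction.orbitRel_apply.1 hvw
      refine MulAction.orbitRel_apply.2 (MulAction.mem_orbit_iff.2 ⟨c, Subtype.ext ?_⟩)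
      change (c : ℂ) • D.act g w = D.act g ((c : ℂ) • (w : Fin (p + 1) → ℂ))
      rw [D.act_smul]
  have hB : Continuous gB := hC.quotient_map' _
  -- `g (γ b) = (g γ g⁻¹) (g b)` on the ball
  have hBsmul : ∀ (γ : ↥D.Γ) (hγ : g * (γ : GL (Fin (p + 1)) D.E) * g⁻¹ ∈ D.Γ) (b : D.ball),
      gB (γ • b) = (⟨g * (γ : GL (Fin (p + 1)) D.E) * g⁻¹, hγ⟩ : ↥D.Γ) • gB b := by
    intro γ hγ b
    induction b using Quotient.inductionOn with
    | h w =>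
      change D.toBall (⟨D.act g (D.act (γ : GL (Fin (p + 1)) D.E) w),
          D.act_mem_cone_of_mem_unitaryGroup hg (γ • w).2⟩ : D.cone) =
        D.toBall ((⟨g * (γ : GL (Fin (p + 1)) D.E) * g⁻¹, hγ⟩ : ↥D.Γ) •
          (⟨D.act g w, D.act_mem_cone_of_mem_unitaryGroup hg w.2⟩ : D.cone))
      refine congrArg D.toBall (Subtype.ext ?_)
      change D.act g (D.act (γ : GL (Fin (p + 1)) D.E) w) =
        D.act (g * (γ : GL (Fin (p + 1)) D.E) * g⁻¹) (D.act g w)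
      rw [← D.act_mul, ← D.act_mul, inv_mul_cancel_right]
  -- and is `M`-to-`N` equivariant in the required sense, so descends to the level covers
  refine ⟨⟨Quotient.map' gB fun b b' hbb' ↦ ?_, hB.quotient_map' _⟩, fun v ↦ rfl⟩
  obtain ⟨m, rfl⟩ := MulAction.orbitRel_apply.1 hbb'
  refine MulAction.orbitRel_apply.2 (MulAction.mem_orbit_iff.2
    ⟨⟨⟨g * ((m : ↥D.Γ) : GL (Fin (p + 1)) D.E) * g⁻¹, hMg _ m.2⟩, hMN _ m.2⟩, ?_⟩)
  change _ = gB ((m : ↥D.Γ) • b')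
  rw [hBsmul (m : ↥D.Γ) (hMg _ m.2) b']
  rfl

/-! ## The stub -/

/-- **Stub H2 — a translated projection applied to a Hecke operator.** For `g, h ∈ U(V)(F)` and a normal
subgroup `M ⊴ Γ` of finite index with `g M g⁻¹ ⊆ N_h`, the translated projection `π_g^M : M \ 𝔹 → X(ℂ)` factors
as `M \ 𝔹 → N_h \ 𝔹 → X(ℂ)`, `M[v] ↦ N_h[g v] ↦ Γ[g v]`, so that the defining identity of `T_h` on `N_h \ 𝔹`
(`levelProj_map_heckeCorrespondenceAction`, `twist_comp_smul`) gives
`(π_g^M)^* (T_h x) = [Γ ∩ h⁻¹Γh : N_h]⁻¹ Σ_{q' ∈ Γ/N_h} (π^M_{h γ_{q'} g})^* x` for any section `γ_{q'} = s q'`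
of `Γ → Γ/N_h` (the summands `N_h[w] ↦ Γ[h γ_{q'} w]` composed with `M[v] ↦ N_h[g v]`).
[cite: Shimura1973, §3.1 Prop. 3.1 and §3.4 (3.4.1)] -/
theorem stub_coverMap_map_hecke :
    ∀ {p : ℕ} {X : SchemeOver ℂ} (D : UnitaryBallQuotientDatum p X) (g h : GL (Fin (p + 1)) D.E)
      (hg : g ∈ unitaryGroup (conjRingHom D.E) D.H) (hh : h ∈ unitaryGroup (conjRingHom D.E) D.H)
      (M : Subgroup ↥D.Γ) [M.Normal] [M.FiniteIndex] [(D.heckeLevel h).FiniteIndex]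
      (hMg : ∀ γ ∈ M, g * (γ : GL (Fin (p + 1)) D.E) * g⁻¹ ∈ D.Γ)
      (hMh : ∀ γ (hγ : γ ∈ M),
        (⟨g * (γ : GL (Fin (p + 1)) D.E) * g⁻¹, hMg γ hγ⟩ : ↥D.Γ) ∈ D.heckeLevel h)
      (s : ↥D.Γ ⧸ D.heckeLevel h → ↥D.Γ) (hs : ∀ q', (QuotientGroup.mk (s q') : ↥D.Γ ⧸ D.heckeLevel h) = q')
      (hu : ∀ q', h * (s q' : GL (Fin (p + 1)) D.E) * g ∈ unitaryGroup (conjRingHom D.E) D.H)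
      (hc : ∀ q', ∀ γ ∈ M, h * (s q' : GL (Fin (p + 1)) D.E) * g * (γ : GL (Fin (p + 1)) D.E) *
        (h * (s q' : GL (Fin (p + 1)) D.E) * g)⁻¹ ∈ D.Γ)
      (k : ℕ) (x : complexBetti X k),
      letI : Fintype (↥D.Γ ⧸ D.heckeLevel h) := Subgroup.fintypeQuotientOfFiniteIndex
      singularCohomology.map ℂ ℂ (D.coverMap g hg hMg) k (D.heckeCorrespondenceAction k h x) =
        ((D.heckeIndex h : ℂ)⁻¹) • ∑ q' : ↥D.Γ ⧸ D.heckeLevel h,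
          singularCohomology.map ℂ ℂ
            (D.coverMap (N := M) (h * (s q' : GL (Fin (p + 1)) D.E) * g) (hu q') (hc q')) k x := by
  intro p X D g h hg hh M _ _ _ hMg hMh s hs hu hc k x
  letI : Fintype (↥D.Γ ⧸ D.heckeLevel h) := Subgroup.fintypeQuotientOfFiniteIndex
  -- `h` is admissible: the defining identity of `T_h` on `N_h \ 𝔹` is available
  have hadm : D.IsHeckeAdmissible h := isHeckeAdmissible_of_mem_unitaryGroup D hh
  -- the change-of-level map `ĝ : M \ 𝔹 → N_h \ 𝔹`, `M[v] ↦ N_h[g v]`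
  obtain ⟨ĝ, hĝ⟩ := coverMapHecke_exists_levelMap D hg M (D.heckeLevel h) hMg hMh
  -- `π_{N_h} ∘ ĝ = π_g^M`
  have ha : (D.levelProj (D.heckeLevel h)).comp ĝ = D.coverMap g hg hMg := by
    refine ContinuousMap.ext fun e ↦ ?_
    induction e using Quotient.inductionOn with
    | h b =>
    induction b using Quotient.inductionOn with
    | h v =>
      change D.levelProj (D.heckeLevel h) (ĝ (D.toLevel M (D.toBall v))) = D.unif (D.act g v)
      rw [hĝ]
      rfl
  -- `π_h ∘ (γ_{q'} N_h) ∘ ĝ = π^M_{h γ_{q'} g}`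
  have hb : ∀ q' : ↥D.Γ ⧸ D.heckeLevel h,
      (hadm.twist.comp ⟨fun e : D.LevelCover (D.heckeLevel h) ↦ q' • e, continuous_const_smul q'⟩).comp ĝ =
        D.coverMap (N := M) (h * (s q' : GL (Fin (p + 1)) D.E) * g) (hu q') (hc q') := by
    intro q'
    refine ContinuousMap.ext fun e ↦ ?_
    induction e using Quotient.inductionOn with
    | h b =>
    induction b using Quotient.inductionOn with
    | h v =>
      change UnitaryBallQuotientDatum.IsHeckeAdmissible.twist D hadm (q' • ĝ (D.toLevel M (D.toBall v))) =
        D.unif (D.act (h * (s q' : GL (Fin (p + 1)) D.E) * g) v)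
      rw [hĝ]
      conv_lhs => rw [← hs q']
      change D.unif (D.act h (D.act ((s q' : ↥D.Γ) : GL (Fin (p + 1)) D.E) (D.act g v))) = _
      rw [D.act_mul, D.act_mul]
  -- pull the defining identity of `T_h` back along `ĝ`
  rw [← ha, singularCohomology.map_comp, ModuleCat.comp_apply,
    D.levelProj_map_heckeCorrespondenceAction hadm k x, map_smul, map_sum]
  congr 1
  refine Finset.sum_congr rfl fun q' _ ↦ ?_
  rw [← hb q', singularCohomology.map_comp ℂ ℂ ĝ, ModuleCat.comp_apply]

end Summit.HodgeConjecture.HodgeConjecture.Cruxes.OrthogonalEnveloped.PuritySortedHeckeEnvelope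

end
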